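import Summits.QuantumFields.BalabanUV.Beta.D1BFx.GluonLegTails
import Summits.QuantumFields.BalabanUV.Beta.D1BFx.LocalTadpoleRows
import Summits.QuantumFields.BalabanUV.Beta.D1BFx.LatticeHLSProfiles

/-!
# `BalabanUV.Beta.D1BFx.GluonLegProfile` — road «BF-x» for binder row D1, slot (K), END row `hGrp gN`, letter (L1) IN PROFILE FORM («GN-L1-PROFILE»):
# THE GLUON LEG `Ga = K^∞` HAS THE DAMPED COULOMB ENTRY PROFILE `|Ga n a x y κ l| ≤ kG·e^{−(δ∕n)‖y−x‖∞}∕nrm(y−x)²` AT EVERY PAIR `(x, y)`, DIAGONAL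
# INCLUDED, modulo [B5, Prop. 1.2] ∧ [B5, (1.126)–(1.127)] BY NAME — the hypothesis shape `|A x y c e| ≤ κ∕nrm(x−y)^a` (a = 2) of the HLS kit's
# `LatticeHLSProfiles.abs_(t)sum_mul_le_of_profiles` ∕ `LatticeHLSPairing.abs_applyK_le_of_profiles`

HONEST DEPENDENCY (cell records, verbatim): «continuum YM on T⁴ ⇐ BetaPertH ∧ nine spine estimates (0/9 proved); BetaPertH ⇐ (D1) ∧ (D4) ∧
CAP+tail; G-an2-4 gates asym, D1 and NE2/3/4.»  HONEST FRAMING (cell contract, verbatim): «discharging `BetaPertH` makes Bałaban's UV stability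
UNCONDITIONAL — a real constructive-QFT result; it is NOT the continuum limit and NOT the Clay problem.»  THIS MODULE DISCHARGES NOTHING of the
wall: [folklore] two-case bookkeeping (diagonal ∕ off-diagonal) over tree letters BY NAME — the off-diagonal damped Coulomb tail
`GluonLegTails.Kinf_entry_le_of_prop12` (leaf-03; CONDITIONAL on the two PRINTED statements `h12`∕`h126`, displayed exactly as the END displays them)
and the hypothesis-free n-free diagonal∕entry bound `LocalTadpoleRows.abs_Ga_le_flatEntry` (leaf-04-g8).  No `def`, no `def … : Prop`, nothing cited,
0 sorry; the printed statements enter as HYPOTHESES by name, never as facts.  Root-level binders hW ∕ hR-sockets ∕ hSX-socket ∕ D1Tel ∕ D1Rep — 0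
discharged; (K) NOT closed; NOT D1, NOT `BetaPertH`, NOT continuum, NOT Clay.

WHY (owner `GLUON-NEEDLE-ROWS.md` v0.1 ∕ RULING ρ-g9-33 (L1) «the vector leg's n-free ENTRY PROFILE `A₀∕nrm²` incl. the diagonal»; an3-g57 §3′ (2)
«vector leg `Ga = Kinf`: d0 `|Kinf((b,κ),(b+w,l))| ≤ A₀·e^{−(δ∕n)‖w‖∞}∕‖w‖∞²`, all components, all `w ≠ 0` (h12∕h126) … the point `w = 0`: … unconditional»;
owner ρ-g10-1 (N2): the kit's packaged bounds take `|K x| ≤ κ∕nrm(x−u)^a`).  The owner's `GluonLegBlockMass` (p261198) is (L1) in BLOCK-MASS form; this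
file is (L1) in the POINTWISE PROFILE form the HLS kit consumes (`nrm = max(1,‖·‖∞)` absorbs the diagonal: `nrm 0 = 1`), so that every
`pairing _ (applyK (Ga n a) _)` ∕ `applyK (Ga n a) φ` of the rank-one frame (`RankOneBubbleJets.biBubble_dSw_dSw`, `bubble_dJetSw_dJetSw`) meets
`LatticeHLSPairing.abs_applyK_le_of_profiles` with `a = 2` directly.

CONTENT.
* `exists_abs_Ga_le_profile (h12) (h126) : ∃ kG δ, 0 < δ ∧ 0 ≤ kG ∧ ∀ n [NeZero n] x y κ l, |Ga n a x y κ l| ≤ kG·e^{−(δ∕n)‖y−x‖∞}∕nrm(y−x)²`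
  (`kG = A₀ + A_d`, `A_d = cG0 4 + (woodburyDc 0 + ellD0 4 a) + ellD0 4 a`; `kG, δ` chosen before `n`: n-free by quantifier order);
* `exists_abs_Ga_le_inv_sq` — the undamped reading `|Ga n a x y κ l| ≤ kG∕nrm(x−y)²` (the kit's `hK`∕`hA` shape, either orientation of the difference).
NOT HERE (honest): the d1 profile (first differences, `∕nrm³`; window rows `DiagonalLegGrade`∕`OffDiagonalLegGrade` + tails `FrozenLegTails`).
Unit `b2b-balaban-beta-d1-formalise-leaf-04` (gen 9); `LEAVES-BFx.md` row (N) «GN-L1-PROFILE».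
-/

noncomputable section

namespace Summit.QuantumFields.BalabanUV.Beta.D1BFx.GluonLegProfile

open Literature.MathematicalPhysics.QuantumFieldTheory.Balaban1983to89
open Literature.MathematicalPhysics.QuantumFieldTheory.Balaban1983to89.Beta
open DyadicShell (Pt)
open PoissonInterior (nrm nrm_pos one_le_nrm nrm_neg supNorm_zero)
open VectorTailsLoc (fam kfam)
open Summit.QuantumFields.BalabanUV.Beta.D1BFx.GluonLeg (Ga Ga_apply)
open Summit.QuantumFields.BalabanUV.Beta.D1BFx.GluonLegTails (Kinf_entry_le_of_prop12)
open Summit.QuantumFields.BalabanUV.Beta.D1BFx.LocalTadpoleRows (abs_Ga_le_flatEntry)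
open Summit.QuantumFields.BalabanUV.Beta.D1BFx.FrozenLegTails (nOf MOf hn1)
open Summit.QuantumFields.BalabanUV.Beta.D1BFx.PointColumnSplit (cG0)
open Summit.QuantumFields.BalabanUV.Beta.D1BFx.LatticeHLSProfiles (supNorm_dyadic nrm_eq_supNorm_of_ne_zero)
open LongitudinalWindow (ellD0)
open WoodburyCovariant (woodburyDc)

variable (a : ℝ) (ha : 0 < a)

/-- [folklore] **(L1) IN PROFILE FORM: THE DAMPED COULOMB ENTRY PROFILE OF THE GLUON LEG AT EVERY PAIR, DIAGONAL INCLUDED**, modulo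
[B5, Prop. 1.2] ∧ [B5, (1.126)–(1.127)] BY NAME: one `kG ≥ 0`, `δ > 0` with `|Ga n a x y κ l| ≤ kG·e^{−(δ∕n)‖y−x‖∞}∕nrm(y−x)²` for every `n ≥ 1`,
`x`, `y`, `κ`, `l` (off the diagonal: `Kinf_entry_le_of_prop12` and `nrm = ‖·‖∞`; on it: `abs_Ga_le_flatEntry` and `nrm 0 = 1`, `e⁰ = 1`). -/
theorem exists_abs_Ga_le_profile (h12 : B5.Prop12Printed (fam nOf hn1 MOf a ha)) (h126 : B5.Kernel126_127Printed (kfam nOf MOf)) :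
    ∃ kG δ : ℝ, 0 < δ ∧ 0 ≤ kG ∧ ∀ (n : ℕ) [NeZero n] (x y : Pt) (κ l : Fin 4),
      |Ga n a x y κ l| ≤ kG * Real.exp (-(δ / n) * PoissonInterior.supNorm (d := 4) (y - x)) / nrm (d := 4) (y - x) ^ 2 := by
  obtain ⟨δ, A₀, hδ, hA₀, hprof⟩ := Kinf_entry_le_of_prop12 a ha h12 h126
  set Ad : ℝ := cG0 4 + (woodburyDc 0 + ellD0 4 a) + ellD0 4 a with hAd_def
  have hAd : 0 ≤ Ad := (abs_nonneg _).trans (abs_Ga_le_flatEntry 1 ha 0 0 0 0)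
  refine ⟨A₀ + Ad, δ, hδ, by positivity, fun n _ x y κ l => ?_⟩
  by_cases hxy : y = x
  · -- the diagonal: `nrm 0 = 1`, `e⁰ = 1`
    subst hxy
    rw [sub_self, supNorm_zero, Nat.cast_zero, mul_zero, Real.exp_zero, mul_one]
    have e1 : nrm (d := 4) (0 : Pt) = 1 := by
      rw [LatticeHLSRadial.nrm_eq_max, supNorm_zero, Nat.cast_zero]; exact max_eq_left zero_le_one
    rw [e1, one_pow, div_one]
    exact (abs_Ga_le_flatEntry n ha y y κ l).trans (by linarith)
  · -- off the diagonal: the printed tail at displacement `w = y − x ≠ 0`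
    have hw : y - x ≠ 0 := sub_ne_zero.mpr hxy
    have h1 := hprof n x (y - x) κ l hw
    rw [add_sub_cancel] at h1
    rw [Ga_apply, nrm_eq_supNorm_of_ne_zero (y - x) hw, ← supNorm_dyadic]
    refine h1.trans ?_
    have hpos : (0 : ℝ) < (DyadicShell.supNorm (y - x) : ℝ) := by exact_mod_cast DyadicShell.supNorm_pos hw
    exact div_le_div_of_nonneg_right (mul_le_mul_of_nonneg_right (by linarith) (Real.exp_pos _).le) (by positivity)

/-- [folklore] **THE UNDAMPED READING** (the kit's `hK`∕`hA` hypothesis shape, `a = 2`, either orientation of the difference):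
`|Ga n a x y κ l| ≤ kG∕nrm(x−y)²` for every `n ≥ 1`, `x`, `y`, `κ`, `l`. -/
theorem exists_abs_Ga_le_inv_sq (h12 : B5.Prop12Printed (fam nOf hn1 MOf a ha)) (h126 : B5.Kernel126_127Printed (kfam nOf MOf)) :
    ∃ kG : ℝ, 0 ≤ kG ∧ ∀ (n : ℕ) [NeZero n] (x y : Pt) (κ l : Fin 4), |Ga n a x y κ l| ≤ kG / nrm (d := 4) (x - y) ^ 2 := by
  obtain ⟨kG, δ, hδ, hkG, h⟩ := exists_abs_Ga_le_profile a ha h12 h126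
  refine ⟨kG, hkG, fun n _ x y κ l => (h n x y κ l).trans ?_⟩
  have hn : (0 : ℝ) < n := by exact_mod_cast Nat.pos_of_ne_zero (NeZero.ne n)
  have hnrm := nrm_pos (d := 4) (y - x)
  rw [← nrm_neg (x - y), neg_sub]
  refine div_le_div_of_nonneg_right ?_ (by positivity)
  have hexp : Real.exp (-(δ / n) * PoissonInterior.supNorm (d := 4) (y - x)) ≤ 1 := by
    rw [Real.exp_le_one_iff]
    have : (0 : ℝ) ≤ δ / n * PoissonInterior.supNorm (d := 4) (y - x) := by positivity
    linarith
  calc kG * Real.exp (-(δ / n) * PoissonInterior.supNorm (d := 4) (y - x)) ≤ kG * 1 := mul_le_mul_of_nonneg_left hexp hkG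
    _ = kG := mul_one _

end Summit.QuantumFields.BalabanUV.Beta.D1BFx.GluonLegProfile

end
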